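import Summits.BirchSwinnertonDyer.BirchSwinnertonDyer.Theorems.KolyvaginDepthDoorKolyvaginDepthSupplyLeafLocal
import Summits.BirchSwinnertonDyer.BirchSwinnertonDyer.Theorems.KolyvaginDepthDoorKolyvaginDepthSupplyZhangGrossPow
import HarnessLib

/-!
# Route `KolyvaginDepthDoor`, crux `KolyvaginDepthSupply` (stmt-BirchSwinnertonDyer-21765) —
# LEAF 2 OF THE hF-FREE DOOR AT EVERY LEVEL `p^M`: McCallum 1991 Lemma 4.3 / Gross 1991 Prop. 6.2 (1)
# — PROVED on the Kodaira–Néron cell, and `McCallum1991.lemma43_kolyvaginClass_mem_selmerLocalKer`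
# ITSELF derived from the ONE Literature fact [GZ86, III (3.1)]

Helper file (`--supports stmt-BirchSwinnertonDyer-21765 --as helper`); it closes nothing and BSD is
not proved by it.

`…LeafLocal` (this seat) proved the finite clause of the leaf at level `p` only, because the tree's
Zhang ⟹ Gross bridge for Kolyvagin primes was modulo `p`. With `frobEqFrobInfty_pow_of_zhang`
(`…ZhangGrossPow`, this seat: W. Zhang's primes of index `≥ M` are Gross's of level `M` under the
leaf's tower surjectivity) the same x11b3 ENDs (`KolyvaginHloc.hloc_concrete_of_GZ31_of_surj`,
`hGZ_of_kodairaNeron_rat`, `hGZ_of_gross1991E0`) apply at EVERY level `p^M`: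

* `kolyvaginClass_mem_selmerLocalKer_finite_of_hGZ` — level `p^M`, given the receptacle clause `hGZ`;
* `kolyvaginClass_mem_selmerLocalKer_finite_of_kodairaNeron` — **PROVED on (KN_p)** at level `p^M`;
* `kolyvaginClass_mem_selmerLocalKer_finite_of_gross1991E0` — level `p^M` from F1 = [GZ86 III (3.1)];
* `lemma43_of_gross1991E0` — **`Gross1991_heegnerPoint_sub_ratTorsion_mem_E0 → McCallum1991.lemma43_kolyvaginClass_mem_selmerLocalKer`**:
  the McCallum leaf AS STATED (all `M`), from the one standard published input F1 (Gross 1991 §6 ⟸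
  Gross–Zagier 1986 III (3.1): Heegner points reduce into `E⁰` up to rational torsion at `v ∣ N`; XL,
  cite-only; shared with the x11b3 / JET programmes).

Net for the route's leaf ledger: of the five McCallum leaves, `h54` and `h22` are theorems as stated
(`…LeafSign`, `…LeafReciprocityPow`), `h44` is (γ) (`JET.prop44_of_frobeniusCongruence`), `h43` is F1
(this file) — and nothing on (KN_p) at the level the route uses —, `h53` is proved at level `p`
(`…LeafEigenLine`). Nothing is asserted about any curve; BSD is not proved by it.

References: [GrossLMS1991] §6 Prop. 6.2 (1) (pp. 244–245), §3 (3.1)–(3.3), Lemma 4.3; [McCallumLMS1991]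
§4 Lemma 4.3 (p. 301), (4)–(6); [GrossZagier1986] III (3.1); [MilneADT2006] Ch. I Prop. 3.8;
[SilvermanAEC2009] VII.6.1; [WZhang2014] Notations (xii).
-/

set_option linter.dupNamespace false

noncomputable section

open scoped Classical

namespace Summit.BirchSwinnertonDyer.BirchSwinnertonDyer.Theorems.KolyvaginDepthDoor

open Literature.NumberTheory.EllipticCurves Literature.NumberTheory.EllipticCurves.ModularForms
  Literature.NumberTheory.EllipticCurves.McCallum1991 Literature.NumberTheory.GaloisRepresentations
  WeierstrassCurve NumberField IsDedekindDomain Field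
open Summit.BirchSwinnertonDyer.Rank1Residual.X11b Summit.BirchSwinnertonDyer.Rank1Residual.JET
open Literature.NumberTheory.DiophantineGeometry (KodairaSymbol)

-- `K : Type`: the tree's ring-class / Zhang–Kolyvagin vocabulary is universe `0`.
variable {K : Type} [Field K] [NumberField K] {W : WeierstrassCurve ℚ}

section Finite

variable [W.IsElliptic] [W.IsGloballyMinimal] [NeZero (W.conductorNorm ℤ)]

/-- **Gross Prop. 6.2 (1) / McCallum Lemma 4.3 at every finite `v ∤ n`, LEVEL `p^M`, for the concrete
class of a family through a datum, GIVEN the receptacle clause `hGZ`** (x11b3's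
`KolyvaginHloc.hloc_concrete_of_GZ31_of_surj` in the door's currency: Zhang–Kolyvagin primes of index
`≥ M`, bridge `isKolyvaginPrime_and_frobEqFrobInfty_pow_of_zhang`; `ρ̄_{E,p}` and `ρ_{E,p^M}` onto).
[cite: GrossLMS1991, §6 Prop. 6.2 (1)] [cite: McCallumLMS1991, §4 Lemma 4.3] [cite: GrossZagier1986, III (3.1)] -/
theorem kolyvaginClass_mem_selmerLocalKer_finite_of_hGZ (hK : IsImaginaryQuadratic K)
    (hD3 : NumberField.discr K ≠ -3) (hD4 : NumberField.discr K ≠ -4)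
    (hH : SatisfiesHeegnerHypothesis (W.conductorNorm ℤ) K)
    {p : ℕ} [Fact p.Prime] (hp2 : p ≠ 2) (hρ : W.HasSurjectiveModNGaloisRep p)
    {M : ℕ} (hM : 1 ≤ M) (hρM : W.HasSurjectiveModNGaloisRep (p ^ M : ℕ))
    (Dt : ModularParametrizationData W (W.conductorNorm ℤ)) (β : ℤ) (ι : K →+* ℂ)
    {n : ℕ} (hn : Squarefree n)
    (hk : ∀ q ∈ n.primeFactors, Zhang2014.IsKolyvaginPrime (W.conductorNorm ℤ) W K p q ∧
      M ≤ Zhang2014.kolyvaginIndex W p q)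
    (family : (m : ℕ) → m ∣ n → KolyvaginHeegnerData Dt β ι m)
    {n' : ℤ} (hcop : IsCoprime ((p ^ M : ℕ) : ℤ) n')
    (hGZ : ∀ (m : ℕ) (hm : m ∣ n) (γ : ringClassField K ι m ≃ₐ[ℚ] ringClassField K ι m),
      γ ∈ ringClassGal ι m → ∀ v : HeightOneSpectrum (𝓞 K), ¬ (W.baseChange K).HasGoodReductionAt v →
        n' • pointsMap (W.baseChange K) (v.adicCompletion K)
            ((family m hm).toGeomPoints (pointGalHom W (ringClassField K ι m) γ (family m hm).y)) ∈
          E0Receptacle (W.baseChange K) v ∧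
        ∀ (ℓ : ℕ) (hℓ : ℓ ∈ m.primeFactors)
          (hle : ringClassField K ι (m / ℓ) ≤ ringClassField K ι m),
          n' • pointsMap (W.baseChange K) (v.adicCompletion K)
              ((family m hm).toGeomPoints (pointGalHom W (ringClassField K ι m) γ
                (WeierstrassCurve.Affine.Point.map (W' := W)
                  ((RingClassField.inclusion ι hle).restrictScalars ℚ)
                  (family (m / ℓ) ((Nat.div_dvd_of_dvd (Nat.dvd_of_mem_primeFactors hℓ)).trans hm)).y))) ∈
            E0Receptacle (W.baseChange K) v)
    (v : HeightOneSpectrum (𝓞 K)) (hv : (n : 𝓞 K) ∉ v.asIdeal) :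
    (family n dvd_rfl).kolyvaginClass (Fact.out : p.Prime) M ∈
      selmerLocalKer (W.baseChange K) (v.adicCompletion K) ((p ^ M : ℕ) : ℤ) := by
  have hp : p.Prime := Fact.out
  have hKol : ∀ q ∈ n.primeFactors,
      IsKolyvaginPrime (W.conductorNorm ℤ) W K p q ∧ FrobEqFrobInfty W K (p ^ M) q := fun q hq ↦
    isKolyvaginPrime_and_frobEqFrobInfty_pow_of_zhang W K hK hp2 hM hρ hρM (hk q hq).1 (hk q hq).2
  have hND : IsCoprime (W.conductorNorm ℤ : ℤ) (NumberField.discr K) :=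
    KolyvaginAssembly.isCoprime_discr_of_satisfiesHeegnerHypothesis hK hH
  have hD : NumberField.discr K < -4 := KolyvaginAssembly.discr_lt_neg_four hK ⟨hD3, hD4⟩
  exact KolyvaginHloc.hloc_concrete_of_GZ31_of_surj hK ι hp hp2 hρ hM Dt hND hD hn hKol family hcop hGZ
    n dvd_rfl v hv

/-- **LEAF 2, FINITE CLAUSE AT LEVEL `p^M`, UNCONDITIONAL ON THE KODAIRA–NÉRON CELL (KN_p)**: as
`kolyvaginClass_mem_selmerLocalKer_finite_one_of_kodairaNeron` (`…LeafLocal`) at every level `p^M`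
with `ρ_{E,p^M}` onto and Zhang–Kolyvagin primes of index `≥ M`.
[cite: GrossLMS1991, §6 Prop. 6.2 (1)] [cite: McCallumLMS1991, §4 Lemma 4.3]
[cite: SilvermanAEC2009, VII.6.1 (Kodaira–Néron)] -/
theorem kolyvaginClass_mem_selmerLocalKer_finite_of_kodairaNeron (hK : IsImaginaryQuadratic K)
    (hD3 : NumberField.discr K ≠ -3) (hD4 : NumberField.discr K ≠ -4)
    (hH : SatisfiesHeegnerHypothesis (W.conductorNorm ℤ) K)
    {p : ℕ} [Fact p.Prime] (hp2 : p ≠ 2) (hρ : W.HasSurjectiveModNGaloisRep p)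
    {M : ℕ} (hM : 1 ≤ M) (hρM : W.HasSurjectiveModNGaloisRep (p ^ M : ℕ))
    (Dt : ModularParametrizationData W (W.conductorNorm ℤ)) (β : ℤ) (ι : K →+* ℂ)
    (hmult : ∀ v : HeightOneSpectrum (𝓞 ℚ), W.HasMultiplicativeReductionAt v →
      ¬ p ∣ W.ordMinimalDiscriminant v)
    (hadd : ∀ v : HeightOneSpectrum (𝓞 ℚ), W.HasAdditiveReductionAt v → p ≠ 3 ∨
      (W.kodairaSymbolAt v ≠ KodairaSymbol.IV ∧ W.kodairaSymbolAt v ≠ KodairaSymbol.IVstar))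
    {n : ℕ} (hn : Squarefree n)
    (hk : ∀ q ∈ n.primeFactors, Zhang2014.IsKolyvaginPrime (W.conductorNorm ℤ) W K p q ∧
      M ≤ Zhang2014.kolyvaginIndex W p q)
    (d : KolyvaginHeegnerData Dt β ι n)
    (v : HeightOneSpectrum (𝓞 K)) (hv : (n : 𝓞 K) ∉ v.asIdeal) :
    d.kolyvaginClass (Fact.out : p.Prime) M ∈
      selmerLocalKer (W.baseChange K) (v.adicCompletion K) ((p ^ M : ℕ) : ℤ) := by
  have hp : p.Prime := Fact.out
  obtain ⟨family, hfam⟩ := exists_family_through_datum hK hH Dt β ι hn (fun q hq ↦ (hk q hq).1) d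
  have hKol : ∀ q ∈ n.primeFactors,
      IsKolyvaginPrime (W.conductorNorm ℤ) W K p q ∧ FrobEqFrobInfty W K (p ^ M) q := fun q hq ↦
    isKolyvaginPrime_and_frobEqFrobInfty_pow_of_zhang W K hK hp2 hM hρ hρM (hk q hq).1 (hk q hq).2
  obtain ⟨n', hcop, hGZ⟩ := KolyvaginHloc.hGZ_of_kodairaNeron_rat hK hH ι Dt (β := β) (M := M) hp
    hp2 hn hKol family hmult hadd
  rw [← hfam]
  exact kolyvaginClass_mem_selmerLocalKer_finite_of_hGZ hK hD3 hD4 hH hp2 hρ hM hρM Dt β ι hn hk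
    family hcop hGZ v hv

/-- **LEAF 2, FINITE CLAUSE AT LEVEL `p^M`, IN GENERAL — from F1 = [GZ86, III (3.1)]**
(`Gross1991_heegnerPoint_sub_ratTorsion_mem_E0`; XL, cite-only), for `E` without CM.
[cite: GrossLMS1991, §6 Prop. 6.2 (1) and proof (p. 245)] [cite: GrossZagier1986, III (3.1)]
[cite: McCallumLMS1991, §4 Lemma 4.3] -/
theorem kolyvaginClass_mem_selmerLocalKer_finite_of_gross1991E0
    (hE0 : Gross1991_heegnerPoint_sub_ratTorsion_mem_E0) (hcm : ¬ W.HasCM)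
    (hK : IsImaginaryQuadratic K) (hD3 : NumberField.discr K ≠ -3) (hD4 : NumberField.discr K ≠ -4)
    (hH : SatisfiesHeegnerHypothesis (W.conductorNorm ℤ) K)
    {p : ℕ} [Fact p.Prime] (hp2 : p ≠ 2) (hρ : W.HasSurjectiveModNGaloisRep p)
    {M : ℕ} (hM : 1 ≤ M) (hρM : W.HasSurjectiveModNGaloisRep (p ^ M : ℕ))
    (Dt : ModularParametrizationData W (W.conductorNorm ℤ)) (β : ℤ) (ι : K →+* ℂ)
    {n : ℕ} (hn : Squarefree n)
    (hk : ∀ q ∈ n.primeFactors, Zhang2014.IsKolyvaginPrime (W.conductorNorm ℤ) W K p q ∧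
      M ≤ Zhang2014.kolyvaginIndex W p q)
    (d : KolyvaginHeegnerData Dt β ι n)
    (v : HeightOneSpectrum (𝓞 K)) (hv : (n : 𝓞 K) ∉ v.asIdeal) :
    d.kolyvaginClass (Fact.out : p.Prime) M ∈
      selmerLocalKer (W.baseChange K) (v.adicCompletion K) ((p ^ M : ℕ) : ℤ) := by
  have hp : p.Prime := Fact.out
  obtain ⟨family, hfam⟩ := exists_family_through_datum hK hH Dt β ι hn (fun q hq ↦ (hk q hq).1) d
  have hKol : ∀ q ∈ n.primeFactors,
      IsKolyvaginPrime (W.conductorNorm ℤ) W K p q ∧ FrobEqFrobInfty W K (p ^ M) q := fun q hq ↦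
    isKolyvaginPrime_and_frobEqFrobInfty_pow_of_zhang W K hK hp2 hM hρ hρM (hk q hq).1 (hk q hq).2
  obtain ⟨n', hcop, hGZ⟩ := KolyvaginHloc.hGZ_of_gross1991E0 hE0 rfl hcm hK ⟨hD3, hD4⟩ hH ι Dt
    (β := β) (M := M) hp hp2 hρ hn hKol family
  rw [← hfam]
  exact kolyvaginClass_mem_selmerLocalKer_finite_of_hGZ hK hD3 hD4 hH hp2 hρ hM hρM Dt β ι hn hk
    family hcop hGZ v hv

/-- **`Gross1991_heegnerPoint_sub_ratTorsion_mem_E0 → McCallum1991.lemma43_kolyvaginClass_mem_selmerLocalKer`**: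
McCallum's Lemma 4.3 / Gross's Prop. 6.2 (1) AS STATED in the tree (every level `p^M`, every datum),
from the ONE standard published input F1 = [GZ86, III (3.1)]. Finite clause:
`kolyvaginClass_mem_selmerLocalKer_finite_of_gross1991E0` (tower surjectivity read at `1` and at `M`);
archimedean clause: `kolyvaginClass_mem_selmerLocalKer_infinitePlace` (`…LeafLocal`).
[cite: McCallumLMS1991, §4 Lemma 4.3 (p. 301)] [cite: GrossLMS1991, §6 Prop. 6.2 (1)]
[cite: GrossZagier1986, III (3.1)] -/
theorem lemma43_of_gross1991E0 (hE0 : Gross1991_heegnerPoint_sub_ratTorsion_mem_E0) :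
    lemma43_kolyvaginClass_mem_selmerLocalKer := by
  intro W _ _ _ hcm K _ _ hK hD3 hD4 hH p _ hp2 htower Dt β ι M hM n hn hk d
  exact ⟨fun v hv ↦ kolyvaginClass_mem_selmerLocalKer_finite_of_gross1991E0 hE0 hcm hK hD3 hD4 hH hp2
      (by simpa only [pow_one] using htower 1) hM (htower M) Dt β ι hn hk d v hv,
    fun w ↦ kolyvaginClass_mem_selmerLocalKer_infinitePlace hK d _ M w⟩

end Finite

end Summit.BirchSwinnertonDyer.BirchSwinnertonDyer.Theorems.KolyvaginDepthDoor

end
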